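import Summits.QuantumFields.BalabanUV.T4Continuum.Spine.NE3.NormalPartB8Lift
import Summits.QuantumFields.BalabanUV.T4Continuum.Spine.NE3.LandauProjectionSupShape
import HarnessLib

/-!
# T⁴ programme, node NE3 — the Landau linear normal part at the lift WITH ITS TWO SUP CURRENCIES read off the F5 shape `LandauCorrectionSupB8`
# (`‖Nn‖ ≤ (liftC∕(1−θ) + K₁)·s∕L^{j+1}`, window sup-curl `≤ (2·liftC(17+16d)∕(L^{j+1})²(1−θ) + 2x·K₀)·s`) — the supplier's `αN`, `aN`

Cell `pub-balaban-gaps` (YM blitz, track G2, seat `ne3`, unit `pub-balaban-gaps-ne3`; writer prover-pub-balaban-gaps-ne3-g4-0, 2026-08-23), census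
`run/shared/lean/pub/pub-balaban-gaps/ne/NE3.md` §4 R24γ4 ∕ §6 NEXT (1).  WHY.  `NormalPartB8Lift.exists_landauNormalPart_lift` (p348740) delivers the Landau linear normal part
`Nn = Y + gaugeDir W λ` (`Y` = the covariant lift of the solved datum, `λ ∈ N(Q′(W))` the Landau correction) with all four ℓ-letters but HIDES `Y` and `λ` behind the
existential, while the supplier `SupplierB8Level.decomposedRepT_slicB8_of_landauRepB8Avg₁` also needs `Nn`'s SUP (`hNsup`) and WINDOW SUP-CURL (`haN`) — the two currencies that
are NOT kinematic (finding F5) and are typed as the shape `LandauProjectionSupShape.LandauCorrectionSupB8 … K₀ K₁` ([Balaban1985BackgroundPropagators] (3.42)∕(3.48) TYPE).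
THIS FILE re-runs the existence proof once, reading the two sup currencies off the shape (`LandauCorrectionSupB8.norm_normalPart_le`, `.norm_curl_gaugeDir_le`) and off the lift's
own sup letters (`QbarRightInverseB8.covLift_solveW_R5`, `CovLiftCurlLettersB8.covLift_solveW_R6`), given a sup bound `‖φ‖ ≤ s` of the coarse datum `φ = QbarIter L (j+1) W Z`.

CONTENT (0 sorry, no `def`): **`exists_landauNormalPart_lift_sup`** — `exists_landauNormalPart_lift`'s conclusion PLUS `∀ y μ, ‖Nn y μ‖ ≤ (liftC∕(1−θ) + K₁)·s∕L^{j+1}` PLUS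
`∀ p ∈ perWin, ‖curl W Nn p‖ ≤ (2·liftC·(17+16d)∕((L^{j+1})²(1−θ)) + 2x·K₀)·s` (`θ = cruxC·(L^{j+1})²x`).

HONEST FRAMING.  Kinematics∕bookkeeping on OUR objects under the displayed shape `LandauCorrectionSupB8` (asserted for nothing); NOTHING of Bałaban's is proved; the supplier's
Π-REG leaf, (P♮) on `slicB8`, `PairLandauGaugeB8Avg`, the covariant root and **NE3 are NOT proved**; spine PROVED 0∕9; finite T⁴ rung (B)+1 — NOT continuum YM on ℝ⁴, NOT infinite
volume, NOT mass gap, NOT `BetaPertH`, NOT Clay.  ABSOLUTE RULE kept.  PLACEMENT: `Summits/QuantumFields/BalabanUV/T4Continuum/Spine/NE3/`; imports accepted modules only.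
-/

set_option autoImplicit false

open scoped BigOperators Matrix Matrix.Norms.L2Operator
open NormedSpace Finset

namespace Summit.QuantumFields.BalabanUV.T4Continuum.NE3.NormalPartB8LiftSup

open Literature.MathematicalPhysics.QuantumFieldTheory.Balaban1983to89
open B7Prop1Explicit B7Prop2Explicit MatrixNorms
open T4AveragingDeficitWall (Ad IsUnitaryCfg IsSkewDir SmallField curl curlAt curlSq dirSq dirL1)
open T4AveragingDeficitWallBoundary (IsPeriodicCfg periodBox)
open AveragingDeficitPeriodicCounting (IsPeriodicDir)
open AveragingDeficitMultiLevelPrep (LevelSmall tower)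
open AveragingDeficitTorusChart (TDir extDir resDir isPeriodicDir_extDir)
open BlockAveragePushDirGauge (gaugeDir)
open MinimalActionLevels (perWin)
open NE3CovariantWeitzenbock (covDiv)
open NE3TangentCovariantTower (QbarIter)
open NE3SmoothRightInverseW (solveW resSkew isSkewDir_QbarIter)
open NE3FramePotBoundW (isPeriodicDir_QbarIter tower_eq_pow_mul)
open NE3CovariantLift (covLift)
open NE3QbarIterCovLiftPrep (cruxC liftC liftC_nonneg)
open NE3RightInverseSolveLetters (thetaLoc)
open SpreadLift (loopRad)
open AveragingDeficitTwoLevelPrep (prop1Radius skewSub)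
open AveragingDeficitNearIdentity (Ad_add)
open NE3.PairLandauB8 (avgKernelGauges IsLandauB8)
open NE3.LandauProjectionB8 (exists_landauB8_correction)
open NE3.LandauProjectionSupShape (LandauCorrectionSupB8)
open NE3.QbarRightInverseB8 (QbarIter_covLift_solveW covLift_solveW_skew covLift_solveW_periodic covLift_solveW_R1 covLift_solveW_R4 covLift_solveW_R5)
open NE3.CovLiftCurlLettersB8 (covLift_solveW_R2 covLift_solveW_R3 covLift_solveW_R6)
open NE3.NormalPartB8 (landauNormalPart_structure landauNormalPart_R1 landauNormalPart_R2)
open NE3.NormalPartB8L1 (landauNormalPart_R3 landauNormalPart_R4)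
open NE3.NormalPartB8Lift (covDiv_lift_le)

noncomputable section

variable {d : ℕ} {n : Type*} [Fintype n] [DecidableEq n]

section Lift

variable [Nonempty n] {L N : ℕ} [NeZero N] (hL : 2 ≤ L) (hN : 1 ≤ N) (hd : 1 ≤ d) (j : ℕ) {W : Site d → Fin d → (Matrix n n ℂ)ˣ} {x : ℝ}
  (hWu : IsUnitaryCfg W) (hWP : IsPeriodicCfg W ((N * L ^ (j + 1) : ℕ) : ℤ)) (hx : 0 ≤ x) (hs : LevelSmall d L j x) (hWx : SmallField W x)
  (hθ : cruxC d L * (((L : ℝ) ^ (j + 1)) ^ 2 * x) < 1) (hθl : thetaLoc d L * (((L : ℝ) ^ (j + 1)) ^ 2 * x) < 1)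
  (hε : ((L : ℝ) ^ (j + 1)) ^ 2 * x ≤ 1)

include hL hN hd hWu hWP hx hs hWx hθ hθl hε in
/-- **THE LANDAU LINEAR NORMAL PART AT THE LIFT — EXISTENCE WITH ALL ℓ-LETTERS AND BOTH SUP CURRENCIES** (hypotheses of
`NormalPartB8Lift.exists_landauNormalPart_lift`, plus the F5 shape `LandauCorrectionSupB8 … K₀ K₁` and a sup bound `‖QbarIter L (j+1) W Z‖ ≤ s`): there is `Nn`, skew,
`(N·L^{j+1})`-periodic, (1.38)-Landau, with `QbarIter L (j+1) W Nn = QbarIter L (j+1) W Z`, the four ℓ-letters (R1)–(R4) of `exists_landauNormalPart_lift` VERBATIM, and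
`‖Nn(y,μ)‖ ≤ (liftC∕(1−θ) + K₁)·s∕L^{j+1}`, `‖curl W Nn p‖ ≤ (2·liftC(17+16d)∕((L^{j+1})²(1−θ)) + 2x·K₀)·s` on the period window (`θ = cruxC·(L^{j+1})²·x`). [folklore] -/
theorem exists_landauNormalPart_lift_sup
    (hPs : 8 * d * (((L : ℝ) ^ (j + 1)) * (((d : ℝ) - 1) * (((L : ℝ) ^ (j + 1)) - 1) * x)) ^ 2
      + 2 * (Fintype.card n * (4 * (d : ℝ) ^ 2 * ((L : ℝ) ^ (j + 1) - 1) ^ 2 * x + 16 * d * loopRad d L ((prop1Radius d L)^[j] x)) ^ 2)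
        ≤ 1 / 2)
    {K₀ K₁ : ℝ} (hsupShape : LandauCorrectionSupB8 hL j hWu hx hs hWx N hθ K₀ K₁)
    {Z : Site d → Fin d → Matrix n n ℂ} (hZs : IsSkewDir Z) (hZP : IsPeriodicDir Z ((N * L ^ (j + 1) : ℕ) : ℤ))
    {s : ℝ} (hs0 : 0 ≤ s) (hφs : ∀ (z : Site d) (κ : Fin d), ‖QbarIter L (j + 1) W Z z κ‖ ≤ s) :
    ∃ Nn : Site d → Fin d → Matrix n n ℂ,
      IsSkewDir Nn ∧ IsPeriodicDir Nn ((N * L ^ (j + 1) : ℕ) : ℤ) ∧ IsLandauB8 (d := d) L N (j + 1) W Nn ∧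
      QbarIter L (j + 1) W Nn = QbarIter L (j + 1) W Z ∧
      dirSq Nn (periodBox (d := d) (N * L ^ (j + 1)))
        ≤ (2 * (liftC d / (1 - thetaLoc d L * (((L : ℝ) ^ (j + 1)) ^ 2 * x))) ^ 2
            + 8 * Fintype.card n * ((d : ℝ) * liftC d ^ 2 * (2 * (d : ℝ) + 8) ^ 2 / (1 - thetaLoc d L * (((L : ℝ) ^ (j + 1)) ^ 2 * x)) ^ 2))
          * (((L : ℝ) ^ (j + 1)) ^ d / ((L : ℝ) ^ (j + 1)) ^ 2) * dirSq (QbarIter L (j + 1) W Z) (periodBox (d := d) N) ∧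
      curlSq W Nn (periodBox (d := d) (N * L ^ (j + 1)))
        ≤ (2 * (4 * d * (liftC d * (17 + 16 * (d : ℝ))) ^ 2 / (1 - thetaLoc d L * (((L : ℝ) ^ (j + 1)) ^ 2 * x)) ^ 2)
            + 128 * Fintype.card (T4AveragingDeficitWall.Plane d) * Fintype.card n
              * ((d : ℝ) * liftC d ^ 2 * (2 * (d : ℝ) + 8) ^ 2 / (1 - thetaLoc d L * (((L : ℝ) ^ (j + 1)) ^ 2 * x)) ^ 2))
          * (((L : ℝ) ^ (j + 1)) ^ d / ((L : ℝ) ^ (j + 1)) ^ 4) * dirSq (QbarIter L (j + 1) W Z) (periodBox (d := d) N) ∧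
      ∑ p ∈ perWin d (N * L ^ (j + 1)), ‖curl W Nn p‖
        ≤ (2 * d * (liftC d * (17 + 16 * (d : ℝ))) / (1 - thetaLoc d L * (((L : ℝ) ^ (j + 1)) ^ 2 * x))
            + 8 * Fintype.card (T4AveragingDeficitWall.Plane d)
              * Real.sqrt (Fintype.card n * ((d : ℝ) * liftC d ^ 2 * (2 * (d : ℝ) + 8) ^ 2 / (1 - thetaLoc d L * (((L : ℝ) ^ (j + 1)) ^ 2 * x)) ^ 2) * (N : ℝ) ^ d))
          * (((L : ℝ) ^ (j + 1)) ^ d / ((L : ℝ) ^ (j + 1)) ^ 2) * dirL1 (QbarIter L (j + 1) W Z) (periodBox (d := d) N) ∧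
      dirL1 Nn (periodBox (d := d) (N * L ^ (j + 1)))
        ≤ (liftC d / (1 - thetaLoc d L * (((L : ℝ) ^ (j + 1)) ^ 2 * x))
            + 2 * Real.sqrt ((d : ℝ) * Fintype.card n * ((d : ℝ) * liftC d ^ 2 * (2 * (d : ℝ) + 8) ^ 2 / (1 - thetaLoc d L * (((L : ℝ) ^ (j + 1)) ^ 2 * x)) ^ 2) * (N : ℝ) ^ d))
          * (((L : ℝ) ^ (j + 1)) ^ d / (L : ℝ) ^ (j + 1)) * dirL1 (QbarIter L (j + 1) W Z) (periodBox (d := d) N) ∧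
      (∀ (y : Site d) (μ : Fin d), ‖Nn y μ‖ ≤ (liftC d / (1 - cruxC d L * (((L : ℝ) ^ (j + 1)) ^ 2 * x)) + K₁) * s / (L : ℝ) ^ (j + 1)) ∧
      (∀ p ∈ perWin d (N * L ^ (j + 1)), ‖curl W Nn p‖
        ≤ (2 * (liftC d * (17 + 16 * (d : ℝ))) / (((L : ℝ) ^ (j + 1)) ^ 2 * (1 - cruxC d L * (((L : ℝ) ^ (j + 1)) ^ 2 * x))) + 2 * x * K₀) * s) := by
  have hL1 : 1 ≤ L := by omega
  -- the coarse datum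
  have hφs' : IsSkewDir (QbarIter L (j + 1) W Z) := isSkewDir_QbarIter hL1 j hWu hx hs hWx hZs
  have hWPt : IsPeriodicCfg W ((tower L N (j + 1) : ℕ) : ℤ) := by rw [tower_eq_pow_mul, Nat.mul_comm]; exact hWP
  have hZPt : IsPeriodicDir Z ((tower L N (j + 1) : ℕ) : ℤ) := by rw [tower_eq_pow_mul, Nat.mul_comm]; exact hZP
  have hφP : IsPeriodicDir (QbarIter L (j + 1) W Z) (N : ℤ) := isPeriodicDir_QbarIter L N (j + 1) hWPt hZPt
  -- the lift of the solved datum and its letters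
  set Y : Site d → Fin d → Matrix n n ℂ :=
    covLift (L ^ (j + 1)) W (extDir N ((solveW hL j hWu hx hs hWx N hθ (resSkew N hφs') : ↥(skewSub d n N)) : TDir d n N)) with hYdef
  have hYQ : QbarIter L (j + 1) W Y = QbarIter L (j + 1) W Z := QbarIter_covLift_solveW hL j hWu hWPt hx hs hWx hθ hφs' hφP
  have hYs : IsSkewDir Y := covLift_solveW_skew (N := N) hL j hWu hx hs hWx hθ hφs'
  have hYP : IsPeriodicDir Y ((N * L ^ (j + 1) : ℕ) : ℤ) := covLift_solveW_periodic hL j hWu hWPt hx hs hWx hθ hφs'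
  have hY1 := covLift_solveW_R1 (N := N) hL j hWu hx hs hWx hθ hθl hφs' hd
  have hY2 := covLift_solveW_R2 (N := N) hL j hWu hx hs hWx hθ hθl hε hφs'
  have hY3 := covLift_solveW_R3 (N := N) hL j hWu hx hs hWx hθ hθl hε hφs'
  have hY4 := covLift_solveW_R4 (N := N) hL j hWu hx hs hWx hθ hθl hφs' hd
  have hY5 := covLift_solveW_R5 (N := N) hL j hWu hx hs hWx hθ hφs' hd hs0 hφs
  have hY6 := covLift_solveW_R6 (N := N) hL j hWu hx hs hWx hθ hε hφs' hs0 hφs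
  have hV := covDiv_lift_le hL hN hd j hWu hx hs hWx hθ hθl hε hφs'
  have hcV : 0 ≤ (d : ℝ) * liftC d ^ 2 * (2 * (d : ℝ) + 8) ^ 2 / (1 - thetaLoc d L * (((L : ℝ) ^ (j + 1)) ^ 2 * x)) ^ 2 := by
    have := liftC_nonneg d; positivity
  -- the Landau correction
  obtain ⟨lam, hlam, hLan⟩ := exists_landauB8_correction hL1 hN j hWu hWP hx hs hWx Y
  obtain ⟨hNs, hNP, hNL, hNQ⟩ := landauNormalPart_structure hL j hWu hWP hx hs hWx hYs hYP hYQ hlam hLan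
  refine ⟨fun y μ => Y y μ + gaugeDir W lam y μ, hNs, hNP, hNL, hNQ, ?_, ?_, ?_, ?_, ?_, ?_⟩
  · exact landauNormalPart_R1 hL hN j hWu hWP hx hs hWx hPs hYP hlam hLan le_rfl hV hY1
  · exact landauNormalPart_R2 hL hN j hWu hWP hx hs hWx hε hPs hYP hlam hLan le_rfl hcV hV hY2
  · exact landauNormalPart_R3 hL hN j hWu hWP hx hs hWx hε hPs hYP hlam hLan le_rfl hcV hV hY3
  · exact landauNormalPart_R4 hL hN j hWu hWP hx hs hWx hPs hYP hlam hLan le_rfl hcV hV hY4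
  · -- the sup currency from the shape
    intro y μ
    exact hsupShape.norm_normalPart_le hL j hWu hx hs hWx N hθ hφs' hφP hs0 hφs hlam hLan hY5 y μ
  · -- the window sup-curl: the lift's curl letter plus the plaquette commutator of the correction
    intro p hp
    have h1 := hY6 p hp
    have h2 := hsupShape.norm_curl_gaugeDir_le hL j hWu hx hs hWx N hθ hφs' hφP hs0 hφs hlam hLan p
    have e : curl W (fun y μ => Y y μ + gaugeDir W lam y μ) p = curl W Y p + curl W (gaugeDir W lam) p := by
      simp only [curl, curlAt, Ad_add]
      abel
    rw [e]
    calc ‖curl W Y p + curl W (gaugeDir W lam) p‖ ≤ ‖curl W Y p‖ + ‖curl W (gaugeDir W lam) p‖ := norm_add_le _ _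
      _ ≤ 2 * (liftC d * (17 + 16 * (d : ℝ))) / (((L : ℝ) ^ (j + 1)) ^ 2 * (1 - cruxC d L * (((L : ℝ) ^ (j + 1)) ^ 2 * x))) * s
            + 2 * x * (K₀ * s) := add_le_add h1 h2
      _ = _ := by ring

end Lift

end

end Summit.QuantumFields.BalabanUV.T4Continuum.NE3.NormalPartB8LiftSup
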